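import Summits.CriticalPhenomena.PercolationContinuityZ3.Theorems.PercNearOneGluingNoHeavyLowerTailSunflowerTBernFloor
import Summits.CriticalPhenomena.PercolationContinuityZ3.Theorems.PercNearOneGluingNoHeavyLowerTailSunflowerTwoLevelPendant
import HarnessLib

/-!
# `NoHeavyLowerTail` (crux stmt-CriticalPhenomena-4575), abstract sunflower cubic: GRADED T-BERN — the coefficient scheme
# (`AdmissibleG`, `DomG`), the bridge `DomG ⇒ GradedTBern`, singletons and floors

Support file (seat `prim-ineq-prove-1` gen 69; `--supports stmt-CriticalPhenomena-4575`).  No `sorry`, no named facts; two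
definitions (`AdmissibleG`, `DomG`), the phantom-block analogues of `AdmissibleOn`, `DomOn` of `…SunflowerTBernFloor`.
Memo: run/shared/lean/prim/prim-ineq-prove-1/FINDING-GRADED-prove1-g69.md.

`GradedTBern s b β` (`…SunflowerTwoLevelPendant`) is the capped pendant inequality with the block budget tightened by a PHANTOM
block `x ∈ [a₀, 1]` (`a₀ = (1−s)b + sβ`): `(∏_j ℓ_j(t))·(t + (1−t)x) ≤ F^(n−1)(t + (1−t)a₀)`.  Exactly as `TBern` is the
`t`-free coefficient form of `CappedPendant` (`…SunflowerTBern`), the graded inequality follows for every `t ∈ [0,1]` from the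
COEFFICIENTWISE domination
  `∏_j (A_j X + g_j) · (X + x) ≤_coef (A₀X + a₀)^(n−1) · (X + a₀)(X + 1)`,   `A_j = s+(1−s)u_j`, `g_j = (1−s)m_j + s·vv_j`,
because both sides are products of `n+1` linear factors and `(t + (1−t)a₀)·(t + (1−t)·1) = t + (1−t)a₀`
(`prod_le_prod_of_tcoeff_le` on `Fin (n+1)`).  This file sets up the finset form of that certificate:
* `AdmissibleG s b β x t u vv m` — the hypotheses (`TBern`-admissibility at `V = 1` plus the tightened block budget
  `(∏ g_j)·x ≤ a₀^|t|`) and `DomG s b β x t u vv m` — the certificate; `AdmissibleG.toOn` (⇒ `AdmissibleOn s b β 1`);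
* **`gradedTBern_of_domG`** — if every nonempty admissible family on a finset of `Fin n` admits `DomG`, then `GradedTBern s b β`;
* `domG_singleton`, floor erasure `admissibleG_erase_floor` / `domG_of_erase_floor` and the floor induction `domG_of_floorFree`.
The reduction to irreducible families and their certificates are the files `…SunflowerGradedTBern{Endgame,State,Moves,Merge,Final}`.
-/

noncomputable section

namespace Summit.CriticalPhenomena.PercolationContinuityZ3.Theorems.SunflowerPartition

namespace SafeCalc

namespace LinkedCurrency

open Finset Polynomial

variable {ι : Type*} [DecidableEq ι]

/-- The hypotheses of the graded T-BERN certificate for a family `(u, vv, m)` on the finset `t` with phantom block `x`: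
`TBern`-admissibility at `V = 1` (bounds, `u`- and `vv`-budgets with exponent `|t|−1`) and the TIGHTENED block budget
`(∏_{j∈t} ((1−s)m_j + s·vv_j))·x ≤ a₀^|t|`. [definition, this work] -/
def AdmissibleG (s b β x : ℝ) (t : Finset ι) (u vv m : ι → ℝ) : Prop :=
  (∀ j ∈ t, b ≤ u j) ∧ (∀ j ∈ t, u j ≤ 1) ∧ (∀ j ∈ t, β ≤ vv j) ∧ (∀ j ∈ t, vv j ≤ 1) ∧ (∀ j ∈ t, b ≤ m j) ∧
    (∀ j ∈ t, m j ≤ u j) ∧ (∀ j ∈ t, m j ≤ vv j) ∧ ∏ j ∈ t, u j ≤ b ^ (t.card - 1) ∧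
    ∏ j ∈ t, vv j ≤ β ^ (t.card - 1) ∧
    (∏ j ∈ t, ((1 - s) * m j + s * vv j)) * x ≤ ((1 - s) * b + s * β) ^ t.card

/-- The graded `CoefDom` certificate of a family on `t` with phantom `x`:
`∏_{j∈t}(A_jX + g_j)·(X + x) ≤_coef (A₀X + a₀)^(|t|−1)·(X + a₀)(X + 1)`. [definition, this work] -/
def DomG (s b β x : ℝ) (t : Finset ι) (u vv m : ι → ℝ) : Prop :=
  CoefDom (prodPoly t (fun j => s + (1 - s) * u j) (fun j => (1 - s) * m j + s * vv j) * (C 1 * X + C x))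
    ((C (s + (1 - s) * b) * X + C ((1 - s) * b + s * β)) ^ (t.card - 1) *
      ((C 1 * X + C ((1 - s) * b + s * β)) * (C 1 * X + C 1)))

omit [DecidableEq ι] in
/-- Admissibility restricts to the pointwise bounds (helper). [this work] -/
theorem AdmissibleG.bounds {s b β x : ℝ} {t : Finset ι} {u vv m : ι → ℝ} (h : AdmissibleG s b β x t u vv m) :
    (∀ j ∈ t, b ≤ u j) ∧ (∀ j ∈ t, u j ≤ 1) ∧ (∀ j ∈ t, β ≤ vv j) ∧ (∀ j ∈ t, vv j ≤ 1) ∧ (∀ j ∈ t, b ≤ m j) ∧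
      (∀ j ∈ t, m j ≤ u j) ∧ (∀ j ∈ t, m j ≤ vv j) :=
  ⟨h.1, h.2.1, h.2.2.1, h.2.2.2.1, h.2.2.2.2.1, h.2.2.2.2.2.1, h.2.2.2.2.2.2.1⟩

omit [DecidableEq ι] in
/-- **`AdmissibleG ⇒ AdmissibleOn` at `V = 1`** (the tightened block budget with `x ≥ a₀ > 0` implies the plain one). [this work] -/
theorem AdmissibleG.toOn {s b β x : ℝ} (hs0 : 0 ≤ s) (hs1 : s ≤ 1) (hb : 0 < b) (hbβ : b ≤ β) (hx : (1 - s) * b + s * β ≤ x)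
    {t : Finset ι} {u vv m : ι → ℝ} (h : AdmissibleG s b β x t u vv m) : AdmissibleOn s b β 1 t u vv m := by
  obtain ⟨hub, hu1, hvβ, hv1, hmb, hmu, hmv, hpu, hpv, hpg⟩ := h
  have hs' : 0 ≤ 1 - s := sub_nonneg.2 hs1
  have hβ : 0 < β := hb.trans_le hbβ
  have ha₀ : 0 < (1 - s) * b + s * β := by nlinarith
  refine ⟨hub, hu1, hvβ, hv1, hmb, hmu, hmv, hpu, by rw [mul_one]; exact hpv, ?_⟩
  rw [mul_one]
  have hP0 : 0 ≤ ∏ j ∈ t, ((1 - s) * m j + s * vv j) := prod_nonneg fun j hj =>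
    add_nonneg (mul_nonneg hs' (hb.le.trans (hmb j hj))) (mul_nonneg hs0 (hβ.le.trans (hvβ j hj)))
  have h1 : (∏ j ∈ t, ((1 - s) * m j + s * vv j)) * ((1 - s) * b + s * β) ≤ ((1 - s) * b + s * β) ^ t.card :=
    (mul_le_mul_of_nonneg_left hx hP0).trans hpg
  rcases Nat.eq_zero_or_pos t.card with hc | hc
  · rw [hc, pow_zero] at h1 ⊢
    rw [Finset.card_eq_zero.1 hc, prod_empty]
  · have e : ((1 - s) * b + s * β) ^ t.card = ((1 - s) * b + s * β) ^ (t.card - 1) * ((1 - s) * b + s * β) := by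
      rw [← pow_succ]; congr 1; omega
    rw [e] at h1
    exact le_of_mul_le_mul_right h1 ha₀

/-! ## Singletons and floors -/

omit [DecidableEq ι] in
/-- **A single admissible petal is certified**: `(A_jX + g_j)(X + x) ≤_coef (X + a₀)(X + 1)` when `g_j·x ≤ a₀`, `a₀ ≤ g_j ≤ 1`,
`x ≤ 1`, `A_j ≤ 1`. [this work] -/
theorem domG_singleton {s b β x : ℝ} (hs0 : 0 ≤ s) (hs1 : s ≤ 1) (hb : 0 < b) (hbβ : b ≤ β)
    (hax : (1 - s) * b + s * β ≤ x) (hx1 : x ≤ 1)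
    {u vv m : ι → ℝ} {j : ι} (h : AdmissibleG s b β x {j} u vv m) : DomG s b β x {j} u vv m := by
  obtain ⟨hub, hu1, hvβ, hv1, hmb, hmu, hmv, -, -, hpg⟩ := h
  have hj : j ∈ ({j} : Finset ι) := mem_singleton_self j
  have hs' : 0 ≤ 1 - s := sub_nonneg.2 hs1
  have hβ : 0 < β := hb.trans_le hbβ
  rw [prod_singleton, card_singleton, pow_one] at hpg
  unfold DomG
  rw [prodPoly_singleton, card_singleton, Nat.sub_self, pow_zero, one_mul]
  have hg1 : (1 - s) * m j + s * vv j ≤ 1 := by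
    nlinarith [mul_le_mul_of_nonneg_left ((hmu j hj).trans (hu1 j hj)) hs', mul_le_mul_of_nonneg_left (hv1 j hj) hs0]
  have hga : (1 - s) * b + s * β ≤ (1 - s) * m j + s * vv j := by
    nlinarith [mul_le_mul_of_nonneg_left (hmb j hj) hs', mul_le_mul_of_nonneg_left (hvβ j hj) hs0]
  have hA1 : s + (1 - s) * u j ≤ 1 := by nlinarith [mul_le_mul_of_nonneg_left (hu1 j hj) hs']
  have hA0 : 0 ≤ s + (1 - s) * u j := add_nonneg hs0 (mul_nonneg hs' (hb.le.trans (hub j hj)))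
  refine coefDom_step (A' := 1) (G' := 1) (by rw [mul_one, one_mul]; exact hA1) (by rw [mul_one]; exact hpg) ?_
  -- `A_j x + g_j ≤ 1 + a₀`: `A_j x ≤ x` and `x + g ≤ 1 + g x ≤ 1 + a₀`
  have hx0 : 0 ≤ x := by nlinarith
  have h1 : (s + (1 - s) * u j) * x ≤ x := by nlinarith
  have h2 : 0 ≤ (1 - x) * (1 - ((1 - s) * m j + s * vv j)) := mul_nonneg (sub_nonneg.2 hx1) (sub_nonneg.2 hg1)
  nlinarith

/-- **Erasing a floor keeps graded admissibility** (the floor contributes exactly `b`, `β`, `a₀` to the budgets). [this work] -/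
theorem admissibleG_erase_floor {s b β x : ℝ} (hb : 0 < b) (hbβ : b ≤ β) (hs0 : 0 ≤ s) (hs1 : s ≤ 1)
    {t : Finset ι} {u vv m : ι → ℝ} (h : AdmissibleG s b β x t u vv m) {j : ι} (hj : j ∈ t)
    (hfl : IsFloor b β u vv m j) (hcard : 2 ≤ t.card) : AdmissibleG s b β x (t.erase j) u vv m := by
  obtain ⟨hub, hu1, hvβ, hv1, hmb, hmu, hmv, hpu, hpv, hpg⟩ := h
  obtain ⟨huj, hvj, hmj⟩ := hfl
  have hβ : 0 < β := hb.trans_le hbβ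
  have hs' : 0 ≤ 1 - s := sub_nonneg.2 hs1
  have ha₀ : 0 < (1 - s) * b + s * β := by
    have : 0 ≤ s * (β - b) := mul_nonneg hs0 (sub_nonneg.2 hbβ)
    nlinarith
  have hce : (t.erase j).card = t.card - 1 := card_erase_of_mem hj
  have hexp : t.card - 1 = ((t.erase j).card - 1) + 1 := by rw [hce]; omega
  have hexp' : t.card = (t.erase j).card + 1 := by rw [hce]; omega
  have sub : ∀ {p : ι → Prop}, (∀ i ∈ t, p i) → ∀ i ∈ t.erase j, p i := fun hp i hi => hp i (mem_of_mem_erase hi)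
  refine ⟨sub hub, sub hu1, sub hvβ, sub hv1, sub hmb, sub hmu, sub hmv, ?_, ?_, ?_⟩
  · rw [← mul_prod_erase t u hj, huj, hexp, pow_succ, mul_comm (b ^ _) b] at hpu
    exact le_of_mul_le_mul_left hpu hb
  · rw [← mul_prod_erase t vv hj, hvj, hexp, pow_succ, mul_comm (β ^ _) β] at hpv
    exact le_of_mul_le_mul_left hpv hβ
  · rw [← mul_prod_erase t (fun j => (1 - s) * m j + s * vv j) hj, hmj, hvj, hexp', pow_succ,
      mul_comm (((1 - s) * b + s * β) ^ _) ((1 - s) * b + s * β), mul_assoc] at hpg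
    exact le_of_mul_le_mul_left hpg ha₀

/-- **Re-inserting a floor keeps the graded certificate.** [this work] -/
theorem domG_of_erase_floor {s b β x : ℝ} (hb : 0 < b) (hbβ : b ≤ β) (hs0 : 0 ≤ s) (hs1 : s ≤ 1)
    {t : Finset ι} {u vv m : ι → ℝ} {j : ι} (hj : j ∈ t) (hfl : IsFloor b β u vv m j) (hne : (t.erase j).Nonempty)
    (h : DomG s b β x (t.erase j) u vv m) : DomG s b β x t u vv m := by
  obtain ⟨huj, hvj, hmj⟩ := hfl
  have hs' : 0 ≤ 1 - s := sub_nonneg.2 hs1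
  have hF₁ : 0 ≤ s + (1 - s) * b := by nlinarith
  have hF₀ : 0 ≤ (1 - s) * b + s * β := by nlinarith [hb.trans_le hbβ]
  have hjt : j ∉ t.erase j := notMem_erase j t
  have hcard : t.card - 1 = ((t.erase j).card - 1) + 1 := by
    rw [card_erase_of_mem hj]; have := hne.card_pos; rw [card_erase_of_mem hj] at this; omega
  unfold DomG at h ⊢
  rw [← insert_erase hj, prodPoly_insert hjt, insert_erase hj, hcard, pow_succ', huj, hmj, hvj]
  have hlin : CoefNonneg (C (s + (1 - s) * b) * X + C ((1 - s) * b + s * β)) := coefNonneg_lin hF₁ hF₀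
  refine ((h.mul_left hlin).of_eq_left ?_).of_eq_right ?_
  · ring
  · ring

/-- **FLOOR INDUCTION (graded).**  If every nonempty floor-free `AdmissibleG` family on a finset of `ι` admits `DomG`, then every
nonempty `AdmissibleG` family does (`0 < b ≤ β`, `0 ≤ s ≤ 1`, `x ≤ 1`). [this work] -/
theorem domG_of_floorFree {s b β x : ℝ} (hb : 0 < b) (hbβ : b ≤ β) (hs0 : 0 ≤ s) (hs1 : s ≤ 1)
    (hax : (1 - s) * b + s * β ≤ x) (hx1 : x ≤ 1)
    (H : ∀ (t : Finset ι) (u vv m : ι → ℝ), t.Nonempty → AdmissibleG s b β x t u vv m →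
      (∀ j ∈ t, ¬ IsFloor b β u vv m j) → DomG s b β x t u vv m)
    (t : Finset ι) (u vv m : ι → ℝ) (hne : t.Nonempty) (hadm : AdmissibleG s b β x t u vv m) :
    DomG s b β x t u vv m := by
  induction' hn : t.card using Nat.strong_induction_on with n ih generalizing t
  by_cases hfloor : ∃ j ∈ t, IsFloor b β u vv m j
  · obtain ⟨j, hj, hfl⟩ := hfloor
    rcases Nat.lt_or_ge t.card 2 with hlt | hge
    · -- `t = {j}`
      have hc1 : t.card = 1 := by have := hne.card_pos; omega
      obtain ⟨i, hi⟩ := card_eq_one.1 hc1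
      have hij : j = i := by rw [hi] at hj; exact mem_singleton.1 hj
      subst hij
      rw [hi] at hadm ⊢
      exact domG_singleton hs0 hs1 hb hbβ hax hx1 hadm
    · have hne' : (t.erase j).Nonempty := by
        rw [← card_pos, card_erase_of_mem hj]; omega
      have hadm' := admissibleG_erase_floor hb hbβ hs0 hs1 hadm hj hfl hge
      have hlt : (t.erase j).card < n := by rw [card_erase_of_mem hj]; omega
      exact domG_of_erase_floor hb hbβ hs0 hs1 hj hfl hne' (ih _ hlt (t.erase j) hne' hadm' rfl)
  · push Not at hfloor
    exact H t u vv m hne hadm hfloor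

/-! ## The bridge to `GradedTBern` -/

/-- The family polynomial over `Fin (n+1)` with data `Fin.cons`-ed at `0` splits off the `0`-th factor. [this work] -/
theorem prodPoly_univ_cons {n : ℕ} (a₀' c₀' : ℝ) (a c : Fin n → ℝ) :
    prodPoly (univ : Finset (Fin (n + 1))) (Fin.cons a₀' a : Fin (n + 1) → ℝ) (Fin.cons c₀' c : Fin (n + 1) → ℝ) =
      (C a₀' * X + C c₀') * prodPoly univ a c := by
  unfold prodPoly
  rw [Fin.prod_univ_succ]
  simp only [Fin.cons_zero, Fin.cons_succ]

/-- **`GradedTBern` from certificates.**  If, for every `n` and every `x ∈ [a₀, 1]`, every nonempty `AdmissibleG` family on a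
finset of `Fin n` admits the certificate `DomG`, then `GradedTBern s b β`. [this work] -/
theorem gradedTBern_of_domG {s b β : ℝ}
    (H : ∀ (n : ℕ) (x : ℝ) (t : Finset (Fin n)) (u vv m : Fin n → ℝ), (1 - s) * b + s * β ≤ x → x ≤ 1 → t.Nonempty →
      AdmissibleG s b β x t u vv m → DomG s b β x t u vv m) :
    GradedTBern s b β := by
  intro n u vv m x t hn hax hx1 ht0 ht1 hub hu1 hvβ hv1 hmb hmu hmv hpu hpv hpg
  set A₀ := s + (1 - s) * b with hA₀
  set a₀ := (1 - s) * b + s * β with ha₀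
  have hadm : AdmissibleG s b β x (univ : Finset (Fin n)) u vv m := by
    refine ⟨fun j _ => hub j, fun j _ => hu1 j, fun j _ => hvβ j, fun j _ => hv1 j, fun j _ => hmb j,
      fun j _ => hmu j, fun j _ => hmv j, ?_, ?_, ?_⟩ <;> rw [card_univ, Fintype.card_fin] <;> assumption
  have hne : (univ : Finset (Fin n)).Nonempty := univ_nonempty_iff.2 ⟨⟨0, hn⟩⟩
  have key := H n x univ u vv m hax hx1 hne hadm
  unfold DomG at key
  rw [card_univ, Fintype.card_fin] at key
  -- the two families on `Fin (n+1)`: phantom / full petal at `0`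
  set a' : Fin (n + 1) → ℝ := Fin.cons 1 (fun j => s + (1 - s) * u j) with ha'
  set c' : Fin (n + 1) → ℝ := Fin.cons x (fun j => (1 - s) * m j + s * vv j) with hc'
  set a'' : Fin (n + 1) → ℝ := Fin.cons 1 (fullFloorA s b) with ha''
  set c'' : Fin (n + 1) → ℝ := Fin.cons 1 (fullFloorG s b β a₀) with hc''
  have hcoef : ∀ k, tcoeff (univ : Finset (Fin (n + 1))) a' c' k ≤ tcoeff (univ : Finset (Fin (n + 1))) a'' c'' k := by
    intro k
    rw [← coeff_prodPoly, ← coeff_prodPoly, ha', hc', ha'', hc'', prodPoly_univ_cons, prodPoly_univ_cons,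
      prodPoly_fullFloor s b β a₀ n hn]
    have e1 : (C (1 : ℝ) * X + C x) * prodPoly univ (fun j => s + (1 - s) * u j) (fun j => (1 - s) * m j + s * vv j) =
        prodPoly univ (fun j => s + (1 - s) * u j) (fun j => (1 - s) * m j + s * vv j) * (C 1 * X + C x) := mul_comm _ _
    have e2 : (C (1 : ℝ) * X + C 1) * ((C A₀ * X + C a₀) ^ (n - 1) * (C 1 * X + C a₀)) =
        (C A₀ * X + C a₀) ^ (n - 1) * ((C 1 * X + C a₀) * (C 1 * X + C 1)) := by ring
    rw [e1, e2]
    exact key k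
  have main := prod_le_prod_of_tcoeff_le univ a' c' a'' c'' ht0 ht1 hcoef
  rw [Fin.prod_univ_succ, Fin.prod_univ_succ] at main
  simp only [ha', hc', ha'', hc'', Fin.cons_zero, Fin.cons_succ] at main
  rw [prod_fullFloor s b β a₀ t n hn] at main
  have hfac : ∀ j, s * t + s * (1 - t) * vv j + (1 - s) * t * u j + (1 - s) * (1 - t) * m j =
      t * (s + (1 - s) * u j) + (1 - t) * ((1 - s) * m j + s * vv j) := fun j => by ring
  rw [prod_congr rfl fun j _ => hfac j]
  have e3 : t + (1 - t) * 1 = (1 : ℝ) := by ring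
  rw [mul_one, e3, one_mul] at main
  rw [mul_comm]
  exact main

end LinkedCurrency

end SafeCalc

end Summit.CriticalPhenomena.PercolationContinuityZ3.Theorems.SunflowerPartition
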